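import Summits.BirchSwinnertonDyer.Rank1Residual.X12.JZeroThreeDescent
import Summits.BirchSwinnertonDyer.Rank1Residual.X12.InertCoreInstancesA
import Summits.BirchSwinnertonDyer.Rank1Residual.X12.InertCoreInstancesB
import Summits.BirchSwinnertonDyer.Rank1Residual.X12.InertCoreInstancesE
import HarnessLib

/-!
# K12r@3 (`j = 0`, CM by `ℚ(√−3)`, `ord_{s=1} L(E,s) = 1`, `p = 3` RAMIFIED): per-class kernel records (B)
# — `1521a1`, `1521b1`, `1728v1`, `1764b1`, `1764c1`, `2700l1`, `2700p1`, `3267d1`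
# (cell `bsd-print-cfram`, seat p4; window `N < 2·10⁴` of the leaf `WAllCornerFRamifiedAtThree`)

HONEST FRAMING (cell `bsd-print-cfram`, run/shared/lean/pub/bsd-print-cfram/, D-0131 (2) print
tier; verbatim in every file of the seat): the cell works the partition leaf
`CornerF ∧ p ramified in the CM field K` (LADDER-BSD row K7r = B13; W-ALL row 12r) in PARTITION
currency — a leaf or a cell counts only when its theorem is in the kernel BY NAME. NO class-wide
theorem for the `p = 3` slice is in print (bsd-wall-cm K12R3-SCOPING-v1 §3); these are PER-CLASS
records, one per isogeny class of the window `N < 2·10⁴` not already booked through a printed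
family (Kriz–Li sextic twists / cube sums: 13 classes), in the booking shape of
`X12/JZeroThreeDescent.lean` (`JZeroThree.bsdp_three_of_noThreeTorsion`, seam
`X12.bsdp_of_sha_torsion_eq_zero` p220351). Definitions = Cremona's minimal models (data);
theorems only otherwise; no named fact; nothing about any curve is ASSERTED — the per-class inputs
enter as hypotheses: `hr` (`ord_{s=1} L(E,s) ≤ 1`; Cremona: `= 1`), `h0` (`Ш(E/ℚ)[3] = 0`: the
CERTIFICATE), `hq`/`hv` (`#Ш_an(E) = q`, `ord₃ q = 0`; Cremona: `#Ш_an = 1` on every member of every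
class below). beyond-print: NO (certificate assembly).

THE CERTIFICATE behind `h0` (two engines, two seats, two code bases; numbers quoted per record):
the `3`-isogeny descent along `φ : E_k → E_{−27k}` (`E_k : y² = x³ + k` the `j = 0` member,
kernel `⟨(0, ±√k)⟩`): `s_φ = dim_𝔽₃ Sel^φ(E_k)`, `s_φ̂ = dim_𝔽₃ Sel^φ̂(E_{−27k})`,
`m = rank + [k ∈ ℚ²] + [−3k ∈ ℚ²]`, `EXCESS = s_φ + s_φ̂ − m = dim Ш(E_k)[φ] + dim Ш(E_{−27k})[φ̂]`;
EXCESS `0` ⟹ `Ш(E_k)[3] = 0 = Ш(E_{−27k})[3]`. Engine 1: x1b `x12sel3.gp` (Kummer images in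
`K(S′,3)`, `bnfcertify`d, local images to the printed size [Schaefer 1996 L.3.8 = BES 2020 Prop. 27],
Cassels' Selmer-ratio identity and BES Prop. 28 checked on every edge), kit j101548 = j101531;
engine 2: sha-2 `iso3kum.gp` run by harvest-1, kit j103487 = j103505; the two engines agree on
`(s_φ, s_φ̂)` on all 1838 members of the 919 classes `N < 5·10⁵` (x1b X12-ROUTE.md §17, harvest-1
GEN 25). `Ш(E)[3] = 0` is a `ℚ`-isogeny invariant inside these classes only through BSD — the record
states it for Cremona's curve 1 (= a `j = 0` member `E_k` up to `ℚ`-isomorphism, `k` quoted), on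
which both engines computed it directly.

Per record: model (new, or REUSED by name with its instances), `IsElliptic`, `IsGloballyMinimal`
(Kraus–Silverman, kernel-decided), `j = 0`, the leaf cell `cornerF_three_<name>`, and
`bsdp_three_<name>` = `BSD(E, 3) ∧ #Ш(E/ℚ)[3^∞] = 1` under `hGZK`, `hr`, `h0`, `hq`, `hv`; the class
form is `JZeroThree.bsdp_three_of_isIsogenous_of_noThreeTorsion` on the same hypotheses.

References: `X12/JZeroThreeDescent.lean`; `X12/MillerStollRecords.lean` §1; `X12/InertCoreInstancesA.lean`
§0 (record conventions); [cite: Cremona1997, Table 1]; [cite: Miller2011LMS, §1 and Def. 1.1];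
[cite: SilvermanAEC2009, VII.1 Remark 1.1 and X.4]; x1b `gen13/sel3j0/SEL3J0-MEMBERS-1838.tsv`
(sha256 in that folder's SHA256SUMS).
-/

set_option autoImplicit false

noncomputable section

open scoped Classical

open WeierstrassCurve Literature.NumberTheory.EllipticCurves
  Literature.NumberTheory.EllipticCurves.ModularForms
  Literature.NumberTheory.EllipticCurves.Rank1Residual
  Literature.NumberTheory.EllipticCurves.Rank1Residual.Typed
  Literature.NumberTheory.EllipticCurves.Rank1Residual.X11RankOneCertificates
  Summit.BirchSwinnertonDyer.BirchSwinnertonDyer.Rank1Residual.X11RankOne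
  Summit.BirchSwinnertonDyer.Rank1Residual.X11b

namespace Summit.BirchSwinnertonDyer.Rank1Residual.X12

/-! ### `1521a1 @ 3` (class `1521a`, `N = 1521 = 3²·13²`) -/
namespace Records
/-- Cremona `1521a1 = [0, 0, 1, 0, 3]`: `y² + y = x³ + 3` (`N = 1521 = 3²·13²`, `j = 0`, CM by `ℤ[ζ₃]`;
`≅ E_k : y² = x³ + k` with `k = 208`; Cremona: rank `1`, `#E(ℚ)_tors = 1`, `∏ c_ℓ = 2`,
`#Ш_an = 1`). [cite: Cremona1997, Table 1 (curve 1521a1)] -/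
def c1521a1 : WeierstrassCurve ℚ := ⟨0, 0, 1, 0, 3⟩

/-- `1521a1` is an elliptic curve (`Δ = -4563 ≠ 0`). [cite: SilvermanAEC2009, III.1] -/
instance isElliptic_c1521a1 : c1521a1.IsElliptic := by
  have h := isElliptic_of_discOf_ne_zero 0 0 1 0 3 (by decide)
  norm_num at h; exact h

set_option maxRecDepth 100000 in
/-- `[0, 0, 1, 0, 3]` is globally minimal (`Δ = -4563`; Kraus–Silverman criterion, kernel-decided).
[cite: SilvermanAEC2009, VII.1 Remark 1.1 and VIII.8] -/
instance isGloballyMinimal_c1521a1 : c1521a1.IsGloballyMinimal := by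
  have h := isGloballyMinimal_of_krausCriterion_bounded 0 0 1 0 3
    (by decide) (by decide) (by decide +kernel)
  norm_num at h; exact h

/-- `j(1521a1) = 0` (`c₄ = 0`). [cite: Cremona1997, Table 1 (curve 1521a1)] -/
theorem c1521a1_j : c1521a1.j = 0 := by
  have hc4 : c1521a1.c₄ = 0 := by
    norm_num [c1521a1, WeierstrassCurve.c₄, WeierstrassCurve.b₂, WeierstrassCurve.b₄]
  rw [WeierstrassCurve.j, hc4]
  simp

end Records

/-- **`(1521a1, 3)` is a cell of the leaf `CornerF ∧ CMRamified` at `3`** (CM by `ℚ(√−3)`,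
`r_an = 1`, `3` bad and ramified), given `ord_{s=1} L(E,s) = 1` (`hr`; Cremona). [folklore] -/
theorem cornerF_three_c1521a1 (hr : Records.c1521a1.analyticRank = 1) : CornerF Records.c1521a1 3 :=
  JZeroThree.cornerF_three_of_j_eq_zero _ Records.c1521a1_j hr

/-- **`BSD(1521a1, 3)` and `#Ш(1521a1/ℚ)[3^∞] = 1`** from GZK (`hGZK`), `ord_{s=1} L(E,s) ≤ 1`
(`hr`), the two-engine `3`-isogeny-descent certificate `Ш(E/ℚ)[3] = 0` (`h0`; 1521a1: k = 208, (s_φ, s_φ̂, m, EXCESS) = (0, 1, 1, 0); 1521a2: k = -5616, (s_φ, s_φ̂, m, EXCESS) = (1, 0, 1, 0);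
engines x1b j101548 / sha-2 j103487, agreeing) and `#Ш_an = q`, `ord₃ q = 0` (`hq`, `hv`; Cremona
`#Ш_an`: 1521a1 1, 1521a2 1). PER CLASS; nothing asserted. [cite: Miller2011LMS, §1 and Def. 1.1]
[cite: Cremona1997, Table 1 (class 1521a)] -/
theorem bsdp_three_c1521a1 (hGZK : rank_eq_analyticRank_of_analyticRank_le_one)
    (hr : Records.c1521a1.analyticRank ≤ 1) (h0 : ∀ x : ↥Records.c1521a1.sha, 3 • x = 0 → x = 0)
    {q : ℚ} (hq : shaAn Records.c1521a1 = (q : ℂ)) (hv : padicValRat 3 q = 0) :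
    BSDp Records.c1521a1 3 ∧ Nat.card (AddCommGroup.primaryComponent Records.c1521a1.sha 3) = 1 :=
  JZeroThree.bsdp_three_of_noThreeTorsion _ hGZK hr h0 hq hv

/-! ### `1521b1 @ 3` (class `1521b`, `N = 1521 = 3²·13²`) -/
namespace Records
/-- Cremona `1521b1 = [0, 0, 1, 0, 7140]`: `y² + y = x³ + 7140` (`N = 1521 = 3²·13²`, `j = 0`, CM by `ℤ[ζ₃]`;
`≅ E_k : y² = x³ + k` with `k = 456976`; Cremona: rank `1`, `#E(ℚ)_tors = 3`, `∏ c_ℓ = 6`,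
`#Ш_an = 1`). [cite: Cremona1997, Table 1 (curve 1521b1)] -/
def c1521b1 : WeierstrassCurve ℚ := ⟨0, 0, 1, 0, 7140⟩

/-- `1521b1` is an elliptic curve (`Δ = -22024729467 ≠ 0`). [cite: SilvermanAEC2009, III.1] -/
instance isElliptic_c1521b1 : c1521b1.IsElliptic := by
  have h := isElliptic_of_discOf_ne_zero 0 0 1 0 7140 (by decide)
  norm_num at h; exact h

set_option maxRecDepth 100000 in
/-- `[0, 0, 1, 0, 7140]` is globally minimal (`Δ = -22024729467`; Kraus–Silverman criterion, kernel-decided).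
[cite: SilvermanAEC2009, VII.1 Remark 1.1 and VIII.8] -/
instance isGloballyMinimal_c1521b1 : c1521b1.IsGloballyMinimal := by
  have h := isGloballyMinimal_of_krausCriterion_bounded 0 0 1 0 7140
    (by decide) (by decide) (by decide +kernel)
  norm_num at h; exact h

/-- `j(1521b1) = 0` (`c₄ = 0`). [cite: Cremona1997, Table 1 (curve 1521b1)] -/
theorem c1521b1_j : c1521b1.j = 0 := by
  have hc4 : c1521b1.c₄ = 0 := by
    norm_num [c1521b1, WeierstrassCurve.c₄, WeierstrassCurve.b₂, WeierstrassCurve.b₄]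
  rw [WeierstrassCurve.j, hc4]
  simp

end Records

/-- **`(1521b1, 3)` is a cell of the leaf `CornerF ∧ CMRamified` at `3`** (CM by `ℚ(√−3)`,
`r_an = 1`, `3` bad and ramified), given `ord_{s=1} L(E,s) = 1` (`hr`; Cremona). [folklore] -/
theorem cornerF_three_c1521b1 (hr : Records.c1521b1.analyticRank = 1) : CornerF Records.c1521b1 3 :=
  JZeroThree.cornerF_three_of_j_eq_zero _ Records.c1521b1_j hr

/-- **`BSD(1521b1, 3)` and `#Ш(1521b1/ℚ)[3^∞] = 1`** from GZK (`hGZK`), `ord_{s=1} L(E,s) ≤ 1`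
(`hr`), the two-engine `3`-isogeny-descent certificate `Ш(E/ℚ)[3] = 0` (`h0`; 1521b1: k = 456976, (s_φ, s_φ̂, m, EXCESS) = (1, 1, 2, 0); 1521b2: k = -12338352, (s_φ, s_φ̂, m, EXCESS) = (1, 1, 2, 0);
engines x1b j101548 / sha-2 j103487, agreeing) and `#Ш_an = q`, `ord₃ q = 0` (`hq`, `hv`; Cremona
`#Ш_an`: 1521b1 1, 1521b2 1). PER CLASS; nothing asserted. [cite: Miller2011LMS, §1 and Def. 1.1]
[cite: Cremona1997, Table 1 (class 1521b)] -/
theorem bsdp_three_c1521b1 (hGZK : rank_eq_analyticRank_of_analyticRank_le_one)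
    (hr : Records.c1521b1.analyticRank ≤ 1) (h0 : ∀ x : ↥Records.c1521b1.sha, 3 • x = 0 → x = 0)
    {q : ℚ} (hq : shaAn Records.c1521b1 = (q : ℂ)) (hv : padicValRat 3 q = 0) :
    BSDp Records.c1521b1 3 ∧ Nat.card (AddCommGroup.primaryComponent Records.c1521b1.sha 3) = 1 :=
  JZeroThree.bsdp_three_of_noThreeTorsion _ hGZK hr h0 hq hv

/-! ### `1728v1 @ 3` (class `1728v`, `N = 1728 = 2⁶·3³`) -/
namespace Records
/-- Cremona `1728v1 = [0, 0, 0, 0, -2]`: `y² = x³ − 2` (`N = 1728 = 2⁶·3³`, `j = 0`, CM by `ℤ[ζ₃]`;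
`≅ E_k : y² = x³ + k` with `k = -2`; Cremona: rank `1`, `#E(ℚ)_tors = 1`, `∏ c_ℓ = 1`,
`#Ш_an = 1`). [cite: Cremona1997, Table 1 (curve 1728v1)] -/
def c1728v1 : WeierstrassCurve ℚ := ⟨0, 0, 0, 0, -2⟩

/-- `1728v1` is an elliptic curve (`Δ = -1728 ≠ 0`). [cite: SilvermanAEC2009, III.1] -/
instance isElliptic_c1728v1 : c1728v1.IsElliptic := by
  have h := isElliptic_of_discOf_ne_zero 0 0 0 0 (-2) (by decide)
  norm_num at h; exact h

set_option maxRecDepth 100000 in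
/-- `[0, 0, 0, 0, -2]` is globally minimal (`Δ = -1728`; Kraus–Silverman criterion, kernel-decided).
[cite: SilvermanAEC2009, VII.1 Remark 1.1 and VIII.8] -/
instance isGloballyMinimal_c1728v1 : c1728v1.IsGloballyMinimal := by
  have h := isGloballyMinimal_of_krausCriterion_bounded 0 0 0 0 (-2)
    (by decide) (by decide) (by decide +kernel)
  norm_num at h; exact h

/-- `j(1728v1) = 0` (`c₄ = 0`). [cite: Cremona1997, Table 1 (curve 1728v1)] -/
theorem c1728v1_j : c1728v1.j = 0 := by
  have hc4 : c1728v1.c₄ = 0 := by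
    norm_num [c1728v1, WeierstrassCurve.c₄, WeierstrassCurve.b₂, WeierstrassCurve.b₄]
  rw [WeierstrassCurve.j, hc4]
  simp

end Records

/-- **`(1728v1, 3)` is a cell of the leaf `CornerF ∧ CMRamified` at `3`** (CM by `ℚ(√−3)`,
`r_an = 1`, `3` bad and ramified), given `ord_{s=1} L(E,s) = 1` (`hr`; Cremona). [folklore] -/
theorem cornerF_three_c1728v1 (hr : Records.c1728v1.analyticRank = 1) : CornerF Records.c1728v1 3 :=
  JZeroThree.cornerF_three_of_j_eq_zero _ Records.c1728v1_j hr

/-- **`BSD(1728v1, 3)` and `#Ш(1728v1/ℚ)[3^∞] = 1`** from GZK (`hGZK`), `ord_{s=1} L(E,s) ≤ 1`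
(`hr`), the two-engine `3`-isogeny-descent certificate `Ш(E/ℚ)[3] = 0` (`h0`; 1728v1: k = -2, (s_φ, s_φ̂, m, EXCESS) = (1, 0, 1, 0); 1728v3: k = 54, (s_φ, s_φ̂, m, EXCESS) = (0, 1, 1, 0);
engines x1b j101548 / sha-2 j103487, agreeing) and `#Ш_an = q`, `ord₃ q = 0` (`hq`, `hv`; Cremona
`#Ш_an`: 1728v1 1, 1728v2 1, 1728v3 1, 1728v4 1). PER CLASS; nothing asserted. [cite: Miller2011LMS, §1 and Def. 1.1]
[cite: Cremona1997, Table 1 (class 1728v)] -/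
theorem bsdp_three_c1728v1 (hGZK : rank_eq_analyticRank_of_analyticRank_le_one)
    (hr : Records.c1728v1.analyticRank ≤ 1) (h0 : ∀ x : ↥Records.c1728v1.sha, 3 • x = 0 → x = 0)
    {q : ℚ} (hq : shaAn Records.c1728v1 = (q : ℂ)) (hv : padicValRat 3 q = 0) :
    BSDp Records.c1728v1 3 ∧ Nat.card (AddCommGroup.primaryComponent Records.c1728v1.sha 3) = 1 :=
  JZeroThree.bsdp_three_of_noThreeTorsion _ hGZK hr h0 hq hv

/-! ### `1764b1 @ 3` (class `1764b`, `N = 1764 = 2²·3²·7²`) -/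
namespace Records
/-- Cremona `1764b1 = [0, 0, 0, 0, -343]`: `y² = x³ − 343` (`N = 1764 = 2²·3²·7²`, `j = 0`, CM by `ℤ[ζ₃]`;
`≅ E_k : y² = x³ + k` with `k = -343`; Cremona: rank `1`, `#E(ℚ)_tors = 2`, `∏ c_ℓ = 24`,
`#Ш_an = 1`). [cite: Cremona1997, Table 1 (curve 1764b1)] -/
def c1764b1 : WeierstrassCurve ℚ := ⟨0, 0, 0, 0, -343⟩

/-- `1764b1` is an elliptic curve (`Δ = -50824368 ≠ 0`). [cite: SilvermanAEC2009, III.1] -/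
instance isElliptic_c1764b1 : c1764b1.IsElliptic := by
  have h := isElliptic_of_discOf_ne_zero 0 0 0 0 (-343) (by decide)
  norm_num at h; exact h

set_option maxRecDepth 100000 in
/-- `[0, 0, 0, 0, -343]` is globally minimal (`Δ = -50824368`; Kraus–Silverman criterion, kernel-decided).
[cite: SilvermanAEC2009, VII.1 Remark 1.1 and VIII.8] -/
instance isGloballyMinimal_c1764b1 : c1764b1.IsGloballyMinimal := by
  have h := isGloballyMinimal_of_krausCriterion_bounded 0 0 0 0 (-343)
    (by decide) (by decide) (by decide +kernel)
  norm_num at h; exact h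

/-- `j(1764b1) = 0` (`c₄ = 0`). [cite: Cremona1997, Table 1 (curve 1764b1)] -/
theorem c1764b1_j : c1764b1.j = 0 := by
  have hc4 : c1764b1.c₄ = 0 := by
    norm_num [c1764b1, WeierstrassCurve.c₄, WeierstrassCurve.b₂, WeierstrassCurve.b₄]
  rw [WeierstrassCurve.j, hc4]
  simp

end Records

/-- **`(1764b1, 3)` is a cell of the leaf `CornerF ∧ CMRamified` at `3`** (CM by `ℚ(√−3)`,
`r_an = 1`, `3` bad and ramified), given `ord_{s=1} L(E,s) = 1` (`hr`; Cremona). [folklore] -/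
theorem cornerF_three_c1764b1 (hr : Records.c1764b1.analyticRank = 1) : CornerF Records.c1764b1 3 :=
  JZeroThree.cornerF_three_of_j_eq_zero _ Records.c1764b1_j hr

/-- **`BSD(1764b1, 3)` and `#Ш(1764b1/ℚ)[3^∞] = 1`** from GZK (`hGZK`), `ord_{s=1} L(E,s) ≤ 1`
(`hr`), the two-engine `3`-isogeny-descent certificate `Ш(E/ℚ)[3] = 0` (`h0`; 1764b1: k = -343, (s_φ, s_φ̂, m, EXCESS) = (0, 1, 1, 0); 1764b3: k = 9261, (s_φ, s_φ̂, m, EXCESS) = (1, 0, 1, 0);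
engines x1b j101548 / sha-2 j103487, agreeing) and `#Ш_an = q`, `ord₃ q = 0` (`hq`, `hv`; Cremona
`#Ш_an`: 1764b1 1, 1764b2 1, 1764b3 1, 1764b4 1). PER CLASS; nothing asserted. [cite: Miller2011LMS, §1 and Def. 1.1]
[cite: Cremona1997, Table 1 (class 1764b)] -/
theorem bsdp_three_c1764b1 (hGZK : rank_eq_analyticRank_of_analyticRank_le_one)
    (hr : Records.c1764b1.analyticRank ≤ 1) (h0 : ∀ x : ↥Records.c1764b1.sha, 3 • x = 0 → x = 0)
    {q : ℚ} (hq : shaAn Records.c1764b1 = (q : ℂ)) (hv : padicValRat 3 q = 0) :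
    BSDp Records.c1764b1 3 ∧ Nat.card (AddCommGroup.primaryComponent Records.c1764b1.sha 3) = 1 :=
  JZeroThree.bsdp_three_of_noThreeTorsion _ hGZK hr h0 hq hv

/-! ### `1764c1 @ 3` (class `1764c`, `N = 1764 = 2²·3²·7²`) -/
namespace Records
/-- Cremona `1764c1 = [0, 0, 0, 0, -28]`: `y² = x³ − 28` (`N = 1764 = 2²·3²·7²`, `j = 0`, CM by `ℤ[ζ₃]`;
`≅ E_k : y² = x³ + k` with `k = -28`; Cremona: rank `1`, `#E(ℚ)_tors = 1`, `∏ c_ℓ = 6`,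
`#Ш_an = 1`). [cite: Cremona1997, Table 1 (curve 1764c1)] -/
def c1764c1 : WeierstrassCurve ℚ := ⟨0, 0, 0, 0, -28⟩

/-- `1764c1` is an elliptic curve (`Δ = -338688 ≠ 0`). [cite: SilvermanAEC2009, III.1] -/
instance isElliptic_c1764c1 : c1764c1.IsElliptic := by
  have h := isElliptic_of_discOf_ne_zero 0 0 0 0 (-28) (by decide)
  norm_num at h; exact h

set_option maxRecDepth 100000 in
/-- `[0, 0, 0, 0, -28]` is globally minimal (`Δ = -338688`; Kraus–Silverman criterion, kernel-decided).
[cite: SilvermanAEC2009, VII.1 Remark 1.1 and VIII.8] -/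
instance isGloballyMinimal_c1764c1 : c1764c1.IsGloballyMinimal := by
  have h := isGloballyMinimal_of_krausCriterion_bounded 0 0 0 0 (-28)
    (by decide) (by decide) (by decide +kernel)
  norm_num at h; exact h

/-- `j(1764c1) = 0` (`c₄ = 0`). [cite: Cremona1997, Table 1 (curve 1764c1)] -/
theorem c1764c1_j : c1764c1.j = 0 := by
  have hc4 : c1764c1.c₄ = 0 := by
    norm_num [c1764c1, WeierstrassCurve.c₄, WeierstrassCurve.b₂, WeierstrassCurve.b₄]
  rw [WeierstrassCurve.j, hc4]
  simp

end Records

/-- **`(1764c1, 3)` is a cell of the leaf `CornerF ∧ CMRamified` at `3`** (CM by `ℚ(√−3)`,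
`r_an = 1`, `3` bad and ramified), given `ord_{s=1} L(E,s) = 1` (`hr`; Cremona). [folklore] -/
theorem cornerF_three_c1764c1 (hr : Records.c1764c1.analyticRank = 1) : CornerF Records.c1764c1 3 :=
  JZeroThree.cornerF_three_of_j_eq_zero _ Records.c1764c1_j hr

/-- **`BSD(1764c1, 3)` and `#Ш(1764c1/ℚ)[3^∞] = 1`** from GZK (`hGZK`), `ord_{s=1} L(E,s) ≤ 1`
(`hr`), the two-engine `3`-isogeny-descent certificate `Ш(E/ℚ)[3] = 0` (`h0`; 1764c1: k = -28, (s_φ, s_φ̂, m, EXCESS) = (0, 1, 1, 0); 1764c2: k = 756, (s_φ, s_φ̂, m, EXCESS) = (1, 0, 1, 0);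
engines x1b j101548 / sha-2 j103487, agreeing) and `#Ш_an = q`, `ord₃ q = 0` (`hq`, `hv`; Cremona
`#Ш_an`: 1764c1 1, 1764c2 1). PER CLASS; nothing asserted. [cite: Miller2011LMS, §1 and Def. 1.1]
[cite: Cremona1997, Table 1 (class 1764c)] -/
theorem bsdp_three_c1764c1 (hGZK : rank_eq_analyticRank_of_analyticRank_le_one)
    (hr : Records.c1764c1.analyticRank ≤ 1) (h0 : ∀ x : ↥Records.c1764c1.sha, 3 • x = 0 → x = 0)
    {q : ℚ} (hq : shaAn Records.c1764c1 = (q : ℂ)) (hv : padicValRat 3 q = 0) :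
    BSDp Records.c1764c1 3 ∧ Nat.card (AddCommGroup.primaryComponent Records.c1764c1.sha 3) = 1 :=
  JZeroThree.bsdp_three_of_noThreeTorsion _ hGZK hr h0 hq hv

/-! ### `2700l1 @ 3` (class `2700l`, `N = 2700 = 2²·3³·5²`) -/
namespace Records
/-! Model `c2700l1 = [0, 0, 0, 0, 5]` (`y² = x³ + 5`; `k = 5`; Cremona: rank `1`, `#E(ℚ)_tors = 1`,
`∏ c_ℓ = 1`, `#Ш_an = 1`) with its `IsElliptic` / `IsGloballyMinimal` instances is REUSED from
`InertCoreInstancesB.lean`. -/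

/-- `j(2700l1) = 0` (`c₄ = 0`). [cite: Cremona1997, Table 1 (curve 2700l1)] -/
theorem c2700l1_j : c2700l1.j = 0 := by
  have hc4 : c2700l1.c₄ = 0 := by
    norm_num [c2700l1, WeierstrassCurve.c₄, WeierstrassCurve.b₂, WeierstrassCurve.b₄]
  rw [WeierstrassCurve.j, hc4]
  simp

end Records

/-- **`(2700l1, 3)` is a cell of the leaf `CornerF ∧ CMRamified` at `3`** (CM by `ℚ(√−3)`,
`r_an = 1`, `3` bad and ramified), given `ord_{s=1} L(E,s) = 1` (`hr`; Cremona). [folklore] -/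
theorem cornerF_three_c2700l1 (hr : Records.c2700l1.analyticRank = 1) : CornerF Records.c2700l1 3 :=
  JZeroThree.cornerF_three_of_j_eq_zero _ Records.c2700l1_j hr

/-- **`BSD(2700l1, 3)` and `#Ш(2700l1/ℚ)[3^∞] = 1`** from GZK (`hGZK`), `ord_{s=1} L(E,s) ≤ 1`
(`hr`), the two-engine `3`-isogeny-descent certificate `Ш(E/ℚ)[3] = 0` (`h0`; 2700l1: k = 5, (s_φ, s_φ̂, m, EXCESS) = (1, 0, 1, 0); 2700l2: k = -135, (s_φ, s_φ̂, m, EXCESS) = (0, 1, 1, 0);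
engines x1b j101548 / sha-2 j103487, agreeing) and `#Ш_an = q`, `ord₃ q = 0` (`hq`, `hv`; Cremona
`#Ш_an`: 2700l1 1, 2700l2 1). PER CLASS; nothing asserted. [cite: Miller2011LMS, §1 and Def. 1.1]
[cite: Cremona1997, Table 1 (class 2700l)] -/
theorem bsdp_three_c2700l1 (hGZK : rank_eq_analyticRank_of_analyticRank_le_one)
    (hr : Records.c2700l1.analyticRank ≤ 1) (h0 : ∀ x : ↥Records.c2700l1.sha, 3 • x = 0 → x = 0)
    {q : ℚ} (hq : shaAn Records.c2700l1 = (q : ℂ)) (hv : padicValRat 3 q = 0) :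
    BSDp Records.c2700l1 3 ∧ Nat.card (AddCommGroup.primaryComponent Records.c2700l1.sha 3) = 1 :=
  JZeroThree.bsdp_three_of_noThreeTorsion _ hGZK hr h0 hq hv

/-! ### `2700p1 @ 3` (class `2700p`, `N = 2700 = 2²·3³·5²`) -/
namespace Records
/-! Model `c2700p1 = [0, 0, 0, 0, 500]` (`y² = x³ + 500`; `k = 500`; Cremona: rank `1`, `#E(ℚ)_tors = 1`,
`∏ c_ℓ = 2`, `#Ш_an = 1`) with its `IsElliptic` / `IsGloballyMinimal` instances is REUSED from
`InertCoreInstancesB.lean`. -/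

/-- `j(2700p1) = 0` (`c₄ = 0`). [cite: Cremona1997, Table 1 (curve 2700p1)] -/
theorem c2700p1_j : c2700p1.j = 0 := by
  have hc4 : c2700p1.c₄ = 0 := by
    norm_num [c2700p1, WeierstrassCurve.c₄, WeierstrassCurve.b₂, WeierstrassCurve.b₄]
  rw [WeierstrassCurve.j, hc4]
  simp

end Records

/-- **`(2700p1, 3)` is a cell of the leaf `CornerF ∧ CMRamified` at `3`** (CM by `ℚ(√−3)`,
`r_an = 1`, `3` bad and ramified), given `ord_{s=1} L(E,s) = 1` (`hr`; Cremona). [folklore] -/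
theorem cornerF_three_c2700p1 (hr : Records.c2700p1.analyticRank = 1) : CornerF Records.c2700p1 3 :=
  JZeroThree.cornerF_three_of_j_eq_zero _ Records.c2700p1_j hr

/-- **`BSD(2700p1, 3)` and `#Ш(2700p1/ℚ)[3^∞] = 1`** from GZK (`hGZK`), `ord_{s=1} L(E,s) ≤ 1`
(`hr`), the two-engine `3`-isogeny-descent certificate `Ш(E/ℚ)[3] = 0` (`h0`; 2700p1: k = 500, (s_φ, s_φ̂, m, EXCESS) = (1, 0, 1, 0); 2700p2: k = -13500, (s_φ, s_φ̂, m, EXCESS) = (0, 1, 1, 0);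
engines x1b j101548 / sha-2 j103487, agreeing) and `#Ш_an = q`, `ord₃ q = 0` (`hq`, `hv`; Cremona
`#Ш_an`: 2700p1 1, 2700p2 1). PER CLASS; nothing asserted. [cite: Miller2011LMS, §1 and Def. 1.1]
[cite: Cremona1997, Table 1 (class 2700p)] -/
theorem bsdp_three_c2700p1 (hGZK : rank_eq_analyticRank_of_analyticRank_le_one)
    (hr : Records.c2700p1.analyticRank ≤ 1) (h0 : ∀ x : ↥Records.c2700p1.sha, 3 • x = 0 → x = 0)
    {q : ℚ} (hq : shaAn Records.c2700p1 = (q : ℂ)) (hv : padicValRat 3 q = 0) :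
    BSDp Records.c2700p1 3 ∧ Nat.card (AddCommGroup.primaryComponent Records.c2700p1.sha 3) = 1 :=
  JZeroThree.bsdp_three_of_noThreeTorsion _ hGZK hr h0 hq hv

/-! ### `3267d1 @ 3` (class `3267d`, `N = 3267 = 3³·11²`) -/
namespace Records
/-! Model `c3267d1 = [0, 0, 1, 0, -333]` (`y² + y = x³ − 333`; `k = -21296`; Cremona: rank `1`, `#E(ℚ)_tors = 1`,
`∏ c_ℓ = 2`, `#Ш_an = 1`) with its `IsElliptic` / `IsGloballyMinimal` instances is REUSED from
`InertCoreInstancesE.lean`. -/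

/-- `j(3267d1) = 0` (`c₄ = 0`). [cite: Cremona1997, Table 1 (curve 3267d1)] -/
theorem c3267d1_j : c3267d1.j = 0 := by
  have hc4 : c3267d1.c₄ = 0 := by
    norm_num [c3267d1, WeierstrassCurve.c₄, WeierstrassCurve.b₂, WeierstrassCurve.b₄]
  rw [WeierstrassCurve.j, hc4]
  simp

end Records

/-- **`(3267d1, 3)` is a cell of the leaf `CornerF ∧ CMRamified` at `3`** (CM by `ℚ(√−3)`,
`r_an = 1`, `3` bad and ramified), given `ord_{s=1} L(E,s) = 1` (`hr`; Cremona). [folklore] -/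
theorem cornerF_three_c3267d1 (hr : Records.c3267d1.analyticRank = 1) : CornerF Records.c3267d1 3 :=
  JZeroThree.cornerF_three_of_j_eq_zero _ Records.c3267d1_j hr

/-- **`BSD(3267d1, 3)` and `#Ш(3267d1/ℚ)[3^∞] = 1`** from GZK (`hGZK`), `ord_{s=1} L(E,s) ≤ 1`
(`hr`), the two-engine `3`-isogeny-descent certificate `Ш(E/ℚ)[3] = 0` (`h0`; 3267d1: k = -21296, (s_φ, s_φ̂, m, EXCESS) = (1, 0, 1, 0); 3267d3: k = 574992, (s_φ, s_φ̂, m, EXCESS) = (0, 1, 1, 0);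
engines x1b j101548 / sha-2 j103487, agreeing) and `#Ш_an = q`, `ord₃ q = 0` (`hq`, `hv`; Cremona
`#Ш_an`: 3267d1 1, 3267d2 1, 3267d3 1, 3267d4 1). PER CLASS; nothing asserted. [cite: Miller2011LMS, §1 and Def. 1.1]
[cite: Cremona1997, Table 1 (class 3267d)] -/
theorem bsdp_three_c3267d1 (hGZK : rank_eq_analyticRank_of_analyticRank_le_one)
    (hr : Records.c3267d1.analyticRank ≤ 1) (h0 : ∀ x : ↥Records.c3267d1.sha, 3 • x = 0 → x = 0)
    {q : ℚ} (hq : shaAn Records.c3267d1 = (q : ℂ)) (hv : padicValRat 3 q = 0) :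
    BSDp Records.c3267d1 3 ∧ Nat.card (AddCommGroup.primaryComponent Records.c3267d1.sha 3) = 1 :=
  JZeroThree.bsdp_three_of_noThreeTorsion _ hGZK hr h0 hq hv


end Summit.BirchSwinnertonDyer.Rank1Residual.X12

end
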